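import Summits.QuantumFields.YangMills.Theorems.BalabanUVNodesN19ChebyshevArcLaws

/-!
# YM-DAG node N19 (= NE7 proper) — EVEN SUPER-GEOMETRIC `Target` DOES NOT GIVE SUMMABLE LAW INCREMENTS: the Chebyshev-arc sequence
# (window remainders `≤ C(θ)·θ^K` for EVERY `θ ∈ (0,1)`, bounded-Lipschitz increments `1∕(2(N+j))` at every other step)

Cell `pub-ymgap`, HUMAN RULING D-0062 (Track A) ∕ D-0149 (work-bound push), R141 (C) wider-strategy seat `pub-ymgap-dag-n19-e` (strategy s3 =
ALTERNATIVE CURRENCY), generation g21, module 10 (lineage module 73).  Route `Summits/QuantumFields/YangMills/Theses/BalabanUVNodes.lean` rev 25,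
cluster item K3⁷ «SpineGivenEndpointR13SepCoPH» (stmt-QuantumFields-20544); filed `--supports` that item `--as helper` (it proves no registered
stub).  COUNT-NEUTRAL: [folklore] over modules 71∕72 (`exists_chebyshevArc_laws`) and module 64 (`abs_log_sub_log_le_of_exp_neg_le`,
`exp_neg_le_mgf_id_of_Icc_symm`) BY NAME; `Spine.NE7.Target` (N19's DECL-target SHAPE) is CONCLUDED for an explicit toy family `Z_K(t) = mgf λ_K(t)`;
no scheme object, no Theses import; NOT a discharge claim.

THE QUESTION (module 70's honest note).  Module 68 showed `Target ⇏ summable law increments` with POLYNOMIALLY decaying window remainders; for the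
programme's GEOMETRIC remainders the per-step law price `≍ log K∕K` (p556871 ∕ p555512) is not summable, but no witness was typed.

THE ANSWER ★★ `exists_target_superGeometric_not_summable_lawIncrements`: for every window `l₀ > 0` there is a sequence of probability laws `λ_K` on
`[−1,1]` with `Spine.NE7.Target 1 l₀ δ (K ↦ t ↦ mgf λ_K(t))` where `δ_K ≤ 4e^{l₀}e^{l₀∕θ²}·θ^K` for EVERY `θ ∈ (0,1)` (so the window remainders decay
faster than ANY geometric sequence — indeed `δ_K = 4e^{l₀}l₀^{m}∕m!`, `m = N + ⌊K∕2⌋ − 1`), together with continuous test functions `g_K`,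
`1`-Lipschitz and `1`-bounded on `[−1,1]`, whose increments `|∫g_K dλ_{K+1} − ∫g_K dλ_K|` are NOT summable (they equal `1∕(2(N+j))` at every even
step `K = 2j`).  THE SEQUENCE: `λ_{2j} = P_{N+j}`, `λ_{2j+1} = Q_{N+j}` — the complementary Chebyshev-arc laws of module 72 at the levels `N + j`,
`N = max(3, ⌈2l₀⌉)`: ALL of them are within `2l₀^{n−1}∕(n−1)!` of ONE base (the uniform law) in mgf on the window, so EVERY step — same level or
next level — costs `≤ 4l₀^{n−1}∕(n−1)!` in mgf and (mgfs `≥ e^{−l₀}`) `≤ 4e^{l₀}l₀^{n−1}∕(n−1)!` in cgf, while the same-level steps pay the level's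
test polynomial exactly `1∕(2n)`.
READING (modules 64 + 68 + this file + p555512): LAW-summable ⇒ `Target` ⇒ LAW-convergent; NEITHER arrow reverses, and the second fails to reverse
even for super-geometrically decaying remainders: the upper rate `Σ_K P(τ_K)` (`P(ε) = log(e+L)∕(1+L)`, `L = log ε⁻¹`) is summable iff (roughly)
`Σ 1∕log τ_K⁻¹ < ∞` — true for `δ_K = e^{−K²}`, false for `δ_K = θ^K` and for `δ_K = l₀^K∕K!`; this file shows the `K!` case is genuinely
non-summable, i.e. p556871's per-step law price is ATTAINED ALONG A SEQUENCE, not merely pairwise.  N19's `Target` with geometric remainders — the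
programme's case — does NOT control the bounded-Lipschitz increments of the string laws summably.

HONEST FRAMING (binding).  Elementary and [folklore] (Chebyshev ∕ Favard perfect splines); a TOY family (no scheme object: `Target`'s `Z` slot is fed
`mgf λ_K`, `vol = 1`); NO consumer in the DAG today (a structural statement about the seat's own currencies); nothing of Bałaban's instantiated; NE7 NOT
PRINTED, NOT proved; N19 NOT discharged; count-neutral.  One finite `T⁴` programme at fixed `ε`; nothing continuum ∕ `ℝ⁴` ∕ OS ∕ mass-gap ∕ Clay.
0 `def` ∕ 0 `sorry`.
-/

noncomputable section

open Real MeasureTheory ProbabilityTheory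

namespace Summit.QuantumFields.YangMills.Theorems.BalabanUVNodesN19TargetNotLawSummableSharp

open Literature.MathematicalPhysics.QuantumFieldTheory.Balaban1983to89
open T4CauchySum (MatchingModConstants)
open Summit.QuantumFields.BalabanUV.T4Continuum.Spine
open Summit.QuantumFields.YangMills.Theorems.BalabanUVNodesN19LawIncrementsTarget (abs_log_sub_log_le_of_exp_neg_le exp_neg_le_mgf_id_of_Icc_symm)
open Summit.QuantumFields.YangMills.Theorems.BalabanUVNodesN19ChebyshevArcLaws (exists_chebyshevArc_laws)

/-- The window remainder `l₀^m∕m!` is dominated by EVERY geometric sequence: `l₀^m∕m! ≤ e^{l₀∕θ²}·θ^{2m}` (`x^m∕m! ≤ eˣ` at `x = l₀∕θ²`). [bookkeeping] -/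
theorem pow_div_factorial_le_exp_mul_pow {l₀ θ : ℝ} (hl₀ : 0 ≤ l₀) (hθ : 0 < θ) (m : ℕ) :
    l₀ ^ m / (m.factorial : ℝ) ≤ Real.exp (l₀ / θ ^ 2) * θ ^ (2 * m) := by
  have h := Real.pow_div_factorial_le_exp (x := l₀ / θ ^ 2) (by positivity) m
  have hθ2m : 0 < (θ ^ 2) ^ m := by positivity
  rw [div_pow, div_right_comm] at h
  rw [pow_mul]
  exact (div_le_iff₀ hθ2m).1 h

/-- **★★ SUPER-GEOMETRIC `Target` WITHOUT SUMMABLE LAW INCREMENTS.**  For every `l₀ > 0` there are probability laws `λ_K` on `[−1,1]` (`K ∈ ℕ`) with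
(i) `Spine.NE7.Target 1 l₀ δ (K ↦ t ↦ mgf λ_K(t))` where `δ_K ≤ 4e^{l₀}e^{l₀∕θ²}θ^K` for EVERY `θ ∈ (0,1)` (matching modulo the constants `0`, window
remainders decaying faster than any geometric sequence), and (ii) continuous test functions `g_K`, `1`-Lipschitz and `1`-bounded on `[−1,1]`, whose
bounded-Lipschitz increments `|∫g_K dλ_{K+1} − ∫g_K dλ_K|` are NOT summable.  (The Chebyshev-arc sequence of the header.) [folklore] -/
theorem exists_target_superGeometric_not_summable_lawIncrements {l₀ : ℝ} (hl₀ : 0 < l₀) :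
    ∃ Λ : ℕ → Measure ℝ, (∀ K, IsProbabilityMeasure (Λ K)) ∧ (∀ K, Λ K (Set.Icc (-1 : ℝ) 1)ᶜ = 0) ∧
      (∃ δ : ℕ → ℝ, NE7.Target 1 l₀ δ (fun K t => mgf id (Λ K) t) ∧
        ∀ θ : ℝ, 0 < θ → θ < 1 → ∀ K : ℕ, δ K ≤ 4 * Real.exp l₀ * Real.exp (l₀ / θ ^ 2) * θ ^ K) ∧
      ∃ g : ℕ → ℝ → ℝ, (∀ K, Continuous (g K)) ∧
        (∀ (K : ℕ) (x y : ℝ), x ∈ Set.Icc (-1 : ℝ) 1 → y ∈ Set.Icc (-1 : ℝ) 1 → |g K x - g K y| ≤ 1 * |x - y|) ∧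
        (∀ (K : ℕ) (x : ℝ), x ∈ Set.Icc (-1 : ℝ) 1 → |g K x| ≤ 1) ∧
        ¬ Summable (fun K => |∫ x, g K x ∂Λ (K + 1) - ∫ x, g K x ∂Λ K|) := by
  classical
  -- the base level `N = max(3, ⌈2l₀⌉)`
  set N : ℕ := max 3 ⌈2 * l₀⌉₊ with hNdef
  have hN3 : 3 ≤ N := le_max_left _ _
  have hNl : 2 * l₀ ≤ N := (Nat.le_ceil _).trans (by exact_mod_cast le_max_right 3 ⌈2 * l₀⌉₊)
  -- the arc laws at the levels `N + j`
  choose P Q iP iQ hPc hQc hmgf g hgc hgL hgB hpay using fun j : ℕ => exists_chebyshevArc_laws (n := N + j) (by omega)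
  haveI : ∀ j, IsProbabilityMeasure (P j) := iP
  haveI : ∀ j, IsProbabilityMeasure (Q j) := iQ
  -- the window remainder `b j = l₀^{N+j−1}∕(N+j−1)!` and its monotonicity
  set b : ℕ → ℝ := fun j => l₀ ^ (N + j - 1) / ((N + j - 1).factorial : ℝ) with hbdef
  have hb0 : ∀ j, 0 ≤ b j := fun j => by positivity
  have hb_anti : ∀ j, b (j + 1) ≤ b j := fun j => by
    simp only [hbdef]
    have e : N + (j + 1) - 1 = (N + j - 1) + 1 := by omega
    rw [e, pow_succ, Nat.factorial_succ, Nat.cast_mul, div_le_div_iff₀ (by positivity) (by positivity)]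
    have hlN : l₀ ≤ ((N + j - 1 : ℕ) : ℝ) + 1 := by
      have : ((N + j - 1 : ℕ) : ℝ) + 1 = (N : ℝ) + j := by rw [Nat.cast_sub (R := ℝ) (by omega)]; push_cast; ring
      rw [this]; linarith [(Nat.cast_nonneg j : (0 : ℝ) ≤ j)]
    have hf : (0 : ℝ) < (N + j - 1).factorial := by positivity
    have hp : (0 : ℝ) ≤ l₀ ^ (N + j - 1) := by positivity
    push_cast
    nlinarith [mul_le_mul_of_nonneg_left hlN (mul_nonneg hp hf.le)]
  -- every step `P_j ↔ Q_j` or `Q_j → P_{j+1}` costs `≤ 4 b_j` in mgf on the window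
  have hmgfPQ : ∀ (j : ℕ) (t : ℝ), |t| ≤ l₀ → |mgf id (Q j) t - mgf id (P j) t| ≤ 4 * b j := fun j t ht => by
    obtain ⟨h1, h2⟩ := hmgf j l₀ t (by push_cast; linarith) ht
    calc |mgf id (Q j) t - mgf id (P j) t|
        ≤ |mgf id (Q j) t - 1 / 2 * ∫ x in (-1 : ℝ)..1, Real.exp (t * x)| +
          |1 / 2 * (∫ x in (-1 : ℝ)..1, Real.exp (t * x)) - mgf id (P j) t| := abs_sub_le _ _ _
      _ = |mgf id (Q j) t - 1 / 2 * ∫ x in (-1 : ℝ)..1, Real.exp (t * x)| +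
          |mgf id (P j) t - 1 / 2 * ∫ x in (-1 : ℝ)..1, Real.exp (t * x)| := by rw [abs_sub_comm (1 / 2 * _) (mgf id (P j) t)]
      _ ≤ 2 * b j + 2 * b j := add_le_add h2 h1
      _ = 4 * b j := by ring
  have hmgfQP : ∀ (j : ℕ) (t : ℝ), |t| ≤ l₀ → |mgf id (P (j + 1)) t - mgf id (Q j) t| ≤ 4 * b j := fun j t ht => by
    obtain ⟨-, h2⟩ := hmgf j l₀ t (by push_cast; linarith) ht
    obtain ⟨h1, -⟩ := hmgf (j + 1) l₀ t (by push_cast; linarith) ht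
    have e : N + (j + 1) - 1 = N + (j + 1) - 1 := rfl
    calc |mgf id (P (j + 1)) t - mgf id (Q j) t|
        ≤ |mgf id (P (j + 1)) t - 1 / 2 * ∫ x in (-1 : ℝ)..1, Real.exp (t * x)| +
          |1 / 2 * (∫ x in (-1 : ℝ)..1, Real.exp (t * x)) - mgf id (Q j) t| := abs_sub_le _ _ _
      _ = |mgf id (P (j + 1)) t - 1 / 2 * ∫ x in (-1 : ℝ)..1, Real.exp (t * x)| +
          |mgf id (Q j) t - 1 / 2 * ∫ x in (-1 : ℝ)..1, Real.exp (t * x)| := by rw [abs_sub_comm (1 / 2 * _) (mgf id (Q j) t)]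
      _ ≤ 2 * b (j + 1) + 2 * b j := add_le_add h1 h2
      _ ≤ 4 * b j := by linarith [hb_anti j]
  -- the sequence and the test functions
  set Λ : ℕ → Measure ℝ := fun K => if Even K then P (K / 2) else Q (K / 2) with hΛ
  refine ⟨Λ, fun K => ?_, fun K => ?_, ⟨fun K => 4 * Real.exp l₀ * b (K / 2), ⟨fun K => ⟨0, fun t ht => ?_⟩, ?_⟩, fun θ hθ0 hθ1 K => ?_⟩,
    fun K => g (K / 2), fun K => hgc _, fun K x y hx hy => hgL _ x y hx hy, fun K x hx => (hgB _ x hx).trans ?_, fun hS => ?_⟩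
  · simp only [hΛ]; split_ifs <;> infer_instance
  · simp only [hΛ]; split_ifs
    · exact hPc _
    · exact hQc _
  · -- the cgf increment at step `K`
    rw [sub_zero, one_mul]
    change |cgf id (Λ (K + 1)) t - cgf id (Λ K) t| ≤ _
    have hlow : ∀ K, Real.exp (-l₀) ≤ mgf id (Λ K) t := fun K => by
      have hc : Λ K (Set.Icc (-1 : ℝ) 1)ᶜ = 0 := by simp only [hΛ]; split_ifs; exacts [hPc _, hQc _]
      haveI : IsProbabilityMeasure (Λ K) := by simp only [hΛ]; split_ifs <;> infer_instance
      exact exp_neg_le_mgf_id_of_Icc_symm (Λ K) hc ht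
    have hm : |mgf id (Λ (K + 1)) t - mgf id (Λ K) t| ≤ 4 * b (K / 2) := by
      rcases Nat.even_or_odd K with ⟨j, rfl⟩ | ⟨j, rfl⟩
      · have h1 : ¬Even (j + j + 1) := by rw [Nat.not_even_iff_odd]; exact ⟨j, by ring⟩
        have e1 : (j + j) / 2 = j := by omega
        have e2 : (j + j + 1) / 2 = j := by omega
        simp only [hΛ, Even.add_self j, if_true, h1, if_false, e1, e2]
        exact hmgfPQ j t ht
      · have h0 : ¬Even (2 * j + 1) := Nat.not_even_iff_odd.2 ⟨j, rfl⟩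
        have h1 : Even (2 * j + 1 + 1) := ⟨j + 1, by ring⟩
        have e1 : (2 * j + 1) / 2 = j := by omega
        have e2 : (2 * j + 1 + 1) / 2 = j + 1 := by omega
        simp only [hΛ, h0, if_false, h1, if_true, e1, e2]
        exact hmgfQP j t ht
    calc |cgf id (Λ (K + 1)) t - cgf id (Λ K) t| = |Real.log (mgf id (Λ (K + 1)) t) - Real.log (mgf id (Λ K) t)| := by rw [cgf, cgf]
      _ ≤ Real.exp l₀ * |mgf id (Λ (K + 1)) t - mgf id (Λ K) t| := abs_log_sub_log_le_of_exp_neg_le (hlow _) (hlow _)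
      _ ≤ Real.exp l₀ * (4 * b (K / 2)) := mul_le_mul_of_nonneg_left hm (Real.exp_pos _).le
      _ = 4 * Real.exp l₀ * b (K / 2) := by ring
  · -- summable (comparison with the geometric sequence `(1∕2)^K`, via the `θ`-bound below at `θ = ½`)
    have hgeo : ∀ K : ℕ, 4 * Real.exp l₀ * b (K / 2) ≤ 4 * Real.exp l₀ * Real.exp (l₀ / (1 / 2) ^ 2) * (1 / 2 : ℝ) ^ K := by
      intro K
      have h := pow_div_factorial_le_exp_mul_pow hl₀.le (by norm_num : (0 : ℝ) < 1 / 2) (N + K / 2 - 1)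
      have hK : K ≤ 2 * (N + K / 2 - 1) := by omega
      have hpow : (1 / 2 : ℝ) ^ (2 * (N + K / 2 - 1)) ≤ (1 / 2 : ℝ) ^ K := pow_le_pow_of_le_one (by norm_num) (by norm_num) hK
      calc 4 * Real.exp l₀ * b (K / 2) ≤ 4 * Real.exp l₀ * (Real.exp (l₀ / (1 / 2) ^ 2) * (1 / 2 : ℝ) ^ (2 * (N + K / 2 - 1))) :=
            mul_le_mul_of_nonneg_left h (by positivity)
        _ ≤ 4 * Real.exp l₀ * (Real.exp (l₀ / (1 / 2) ^ 2) * (1 / 2 : ℝ) ^ K) :=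
            mul_le_mul_of_nonneg_left (mul_le_mul_of_nonneg_left hpow (by positivity)) (by positivity)
        _ = _ := by ring
    exact Summable.of_nonneg_of_le (fun K => by positivity) hgeo
      ((summable_geometric_of_lt_one (by norm_num) (by norm_num)).mul_left _)
  · -- `δ_K ≤ 4e^{l₀}e^{l₀∕θ²}θ^K`
    have h := pow_div_factorial_le_exp_mul_pow hl₀.le hθ0 (N + K / 2 - 1)
    have hK : K ≤ 2 * (N + K / 2 - 1) := by omega
    have hpow : θ ^ (2 * (N + K / 2 - 1)) ≤ θ ^ K := pow_le_pow_of_le_one hθ0.le hθ1.le hK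
    calc 4 * Real.exp l₀ * b (K / 2) ≤ 4 * Real.exp l₀ * (Real.exp (l₀ / θ ^ 2) * θ ^ (2 * (N + K / 2 - 1))) :=
          mul_le_mul_of_nonneg_left h (by positivity)
      _ ≤ 4 * Real.exp l₀ * (Real.exp (l₀ / θ ^ 2) * θ ^ K) :=
          mul_le_mul_of_nonneg_left (mul_le_mul_of_nonneg_left hpow (by positivity)) (by positivity)
      _ = 4 * Real.exp l₀ * Real.exp (l₀ / θ ^ 2) * θ ^ K := by ring
  · -- `1∕(2(N + K∕2)) ≤ 1`
    rw [div_le_one (by positivity)]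
    have : (1 : ℝ) ≤ ((N + K / 2 : ℕ) : ℝ) := by exact_mod_cast (by omega : 1 ≤ N + K / 2)
    linarith
  · -- not summable: the even steps pay `1∕(2(N+j))`
    have h2 : Summable (fun j : ℕ => |∫ x, g ((2 * j) / 2) x ∂Λ (2 * j + 1) - ∫ x, g ((2 * j) / 2) x ∂Λ (2 * j)|) :=
      hS.comp_injective (fun a b h => by simpa using h : Function.Injective fun j : ℕ => 2 * j)
    have h3 : ∀ j : ℕ, |∫ x, g ((2 * j) / 2) x ∂Λ (2 * j + 1) - ∫ x, g ((2 * j) / 2) x ∂Λ (2 * j)| = 1 / (2 * ((N + j : ℕ) : ℝ)) := by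
      intro j
      have h0 : ¬Even (2 * j + 1) := Nat.not_even_iff_odd.2 ⟨j, rfl⟩
      have e1 : 2 * j / 2 = j := by omega
      have e2 : (2 * j + 1) / 2 = j := by omega
      simp only [hΛ, even_two_mul, if_true, h0, if_false, e1, e2]
      rw [abs_sub_comm, hpay j, abs_of_pos (by positivity)]
    simp_rw [h3] at h2
    have h4 : Summable (fun j : ℕ => 1 / (((j + N : ℕ)) : ℝ)) := by
      refine ((h2.mul_left 2).congr fun j => ?_)
      have : (0 : ℝ) < ((N + j : ℕ) : ℝ) := by exact_mod_cast (by omega : 0 < N + j)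
      rw [Nat.add_comm j N]
      field_simp
    exact Real.not_summable_one_div_natCast ((summable_nat_add_iff N).1 h4)

end Summit.QuantumFields.YangMills.Theorems.BalabanUVNodesN19TargetNotLawSummableSharp

end
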